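import Summits.HodgeConjecture.HodgeConjecture.Theorems.SixfoldTableXCensusSimpleRows
import HarnessLib

/-!
# TABLE X (dimension 6) — row 6 `g6.II(3)` in its literal form: a SIMPLE sixfold with NON-COMMUTATIVE `End⁰` is not of
# CM type, so the census verdict of L10 needs no dimension-count hypothesis (cell `pub-hodgeav-hg6`, req-37 (A) Q2b;
# eng-5 g3, sequel of L10 `SixfoldTableXCensusSimpleRows`, kept apart to respect the 400-line module bound)

HONEST FRAMING. HC, `HC_AV` (stmt-1333), `HC_CM` (stmt-3052) and the rung H2 are NOT proved and do not occur here. The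
census nodes X2 / X1 (`TableX.SixfoldCodimTwoCensus` / `TableX.SixfoldCodimThreeCensus`) are OURS (`@[conjecture]`), never
asserted. KERNEL ONLY: two theorems over existing declarations; no definition, no `sorry`, no named fact; typed ≠ proved.

CONTENT. L10's `SimpleRows.census_row6_of_isSimple_of_noncomm` displays the hypothesis `dim_ℚ End⁰(B) ≤ 12`. For a SIMPLE
abelian variety that inequality is a tree theorem — `dim_ℚ End⁰(B) ∣ 2 dim B`
(`Literature.AlgebraicGeometry.ComplexMultiplication.finrank_endAlgebra_dvd_two_mul_dim`, Mumford §19 Cor. 2 of Thm. 1 via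
the rational representation) —, so:
* `SimpleRows.not_isOfCMType_of_isSimple_of_noncomm` — a simple complex abelian variety of positive dimension whose
  endomorphism algebra is NOT commutative (Albert types II, III, IV with `d > 1`) is NOT of CM type; UNCONDITIONAL;
* `SimpleRows.census_row6_of_isSimple_of_noncomm'` — TABLE X row 6 literally: `B` simple, `dim B = 6`, `End⁰(B)`
  non-commutative and containing a self-commutant totally real sextic field `K` (every simple type-II(3) sixfold, by the
  Albert MEMBERSHIP prose of `Ring2AtlasTypeIIRows`) ⟹ every `A ∼ B` is in the nodes' domain `dim 6 ∧ ¬ 𝒞` AND satisfies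
  X2-at-`A` ∧ X1-at-`A` (Murty 1988 Thm. 2, `m = 1`, a tree theorem; L10 §3). UNCONDITIONAL.
All declarations in the sub-namespace `TableX.SimpleRows` (lead g2 DEDUP RULE 20:17:40Z). Nothing here is a corollary of
`HC_CM`; no hypothesis of the cover is discharged globally; X2 / X1 stay `@[conjecture]`.
-/

set_option linter.dupNamespace false

noncomputable section

open CategoryTheory
open Literature.AlgebraicGeometry Literature.AlgebraicGeometry.Motives
open Literature.AlgebraicGeometry.Motives.AbelianVariety (IsIsogenous IsSimple)
open Literature.AlgebraicGeometry.HodgeTheory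
open Literature.AlgebraicGeometry.Milne1999
open Literature.AlgebraicTopology.SingularHomology
open Literature.Barriers.HodgeConjecture
open Summit.HodgeConjecture.HodgeConjecture.Ring2.ClassTargets
open Summit.HodgeConjecture.HodgeConjecture.Ring2.Motiv (ProdCMCell)
open Summit.HodgeConjecture.HodgeConjecture.Ring2.Atlas (IsQuarticFieldTypeIVFourfold)

namespace Summit.HodgeConjecture.HodgeConjecture.TableX.SimpleRows

section RowSixPrime

variable {K : Type} [Field K] [NumberField K]

/-- **A SIMPLE complex abelian variety of positive dimension with NON-COMMUTATIVE endomorphism algebra is NOT of CM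
type** (Albert types II, III, and IV with `d > 1`): `dim_ℚ End⁰(B) ∣ 2 dim B` for simple `B` (tree theorem
`ComplexMultiplication.finrank_endAlgebra_dvd_two_mul_dim`), hence `≤ 2 dim B`, and a commutative subalgebra of dimension
`2 dim B` would be all of `End⁰(B)` (§1 `not_isOfCMType_of_noncomm_of_finrank_endAlgebra_le`). UNCONDITIONAL.
[cite: MumfordAV1970, §19 Cor. 2 of Thm. 1 (p. 174) and §21 (Albert types)] [cite: Milne1999, §2 p. 54]
[cite: SwinnertonDyer1974, §10 proof of Lemma 44] -/
theorem not_isOfCMType_of_isSimple_of_noncomm {B : AbelianVariety ℂ} (hs : B.IsSimple) (h0 : 0 < B.dim)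
    (hnc : ∃ x y : B.endAlgebra, x * y ≠ y * x) : ¬ IsOfCMType B :=
  not_isOfCMType_of_noncomm_of_finrank_endAlgebra_le
    (Nat.le_of_dvd (by omega) (Literature.AlgebraicGeometry.ComplexMultiplication.finrank_endAlgebra_dvd_two_mul_dim hs))
    hnc

/-- **TABLE X ROW 6 `g6.II(3)`, the literal row, WITH DOMAIN MEMBERSHIP and no dimension-count hypothesis**: for a SIMPLE
complex abelian sixfold `B` with NON-COMMUTATIVE `End⁰(B)` containing a self-commutant TOTALLY REAL SEXTIC field `K`
(every simple sixfold of type II(3): `End⁰` an indefinite quaternion algebra over a totally real cubic field, `K` a maximal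
subfield — Albert MEMBERSHIP prose as in `Ring2AtlasTypeIIRows`), every `A ∼ B` is in the nodes' domain `dim 6 ∧ ¬ 𝒞` AND
satisfies X2-at-`A` ∧ X1-at-`A`. UNCONDITIONAL (Murty 1988 Thm. 2, `m = 1`, and Mumford §19 Cor. 2, both tree theorems).
[cite: Murty1988, Thm. 2 (p. 67) and p. 66] [cite: MumfordAV1970, §19 Cor. 2 of Thm. 1 (p. 174) and §21 (type II)]
[cite: Milne1999, §2 p. 54] [cite: MoonenZarhin1999LowDim, (1.8) and §5 (5.1)] -/
theorem census_row6_of_isSimple_of_noncomm' {A B : AbelianVariety ℂ} (hB : B.dim = 6) (hs : B.IsSimple)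
    (hnc : ∃ x y : B.endAlgebra, x * y ≠ y * x)
    (hK : NumberField.IsTotallyReal K) (h6 : Module.finrank ℚ K = 6) (φ : K →+* B.endAlgebra)
    (hφ : ∀ x : B.endAlgebra, (∀ y : K, Commute x (φ y)) → x ∈ Set.range φ) (hAB : IsIsogenous A B) :
    (A.dim = 6 ∧ ¬ (IsOfCMType A ∨ ProdCMCell IsQuarticFieldTypeIVFourfold (fun Z ↦ Z.dim = 2) A)) ∧
    (∀ c : complexBetti A.X (2 * 2), IsRationalClass c → IsOfHodgeType A.dim A.X (2 * 2) 2 2 c →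
      c ∈ divisorClassesSpan A.X A.dim 2 ⊔ Submodule.span ℂ {w' : complexBetti A.X (2 * 2) |
        ∃ (C : AbelianVariety ℂ) (g : A.X ⟶ C.X) (w : complexBetti C.X (2 * 2)), C.dim < A.dim ∧
          IsRationalClass w ∧ IsOfHodgeType C.dim C.X (2 * 2) 2 2 w ∧ w' = complexBetti.map g (2 * 2) w}) ∧
    (∀ c : complexBetti A.X (2 * 3), IsRationalClass c → IsOfHodgeType A.dim A.X (2 * 3) 3 3 c →
      c ∈ divisorClassesSpan A.X A.dim 3 ⊔ Submodule.span ℂ {w' : complexBetti A.X (2 * 3) |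
          ∃ (a : complexBetti A.X (2 * 2)) (b : complexBetti A.X (2 * 1)),
            IsRationalClass a ∧ IsOfHodgeType A.dim A.X (2 * 2) 2 2 a ∧ IsRationalClass b ∧
            IsOfHodgeType A.dim A.X (2 * 1) 1 1 b ∧ w' = cupProduct (two_mul_add_two_mul 2 1) a b} ⊔
        Submodule.span ℂ {w' : complexBetti A.X (2 * 3) |
          ∃ (C : AbelianVariety ℂ) (g : A.X ⟶ C.X) (w : complexBetti C.X (2 * 3)), C.dim < A.dim ∧
            IsRationalClass w ∧ IsOfHodgeType C.dim C.X (2 * 3) 3 3 w ∧ w' = complexBetti.map g (2 * 3) w} ⊔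
        Submodule.span ℂ {w' : complexBetti A.X (2 * 3) |
          ∃ (B' : AbelianVariety ℂ) (g : A.X ⟶ B'.X) (d : ℕ) (ψ : B' ⟶ B') (w : complexBetti B'.X (2 * 3)),
            B'.dim = 6 ∧ 0 < d ∧ ψ ≫ ψ = -(d • 𝟙 B') ∧ IsRationalClass w ∧
            IsOfHodgeType B'.dim B'.X (2 * 3) 3 3 w ∧ w ∈ weilClassesOf B' ψ 3 d ∧
            w' = complexBetti.map g (2 * 3) w}) :=
  ⟨offResidueSix_of_isIsogenous_of_isSimple_of_not_isOfCMType hAB hB hs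
      (not_isOfCMType_of_isSimple_of_noncomm hs (by omega) hnc),
    census_sixfold_totallyRealSexticMaxSubfield_of_isIsogenous hB hK h6 φ hφ hAB⟩

end RowSixPrime

end Summit.HodgeConjecture.HodgeConjecture.TableX.SimpleRows
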